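import Summits.HodgeConjecture.HodgeConjecture.Theorems.Ring2HypothesesDescentAbsoluteExteriorPullbacks
import Literature.AlgebraicGeometry.Milne1999.LefschetzGroupCentraliserInclusion
import HarnessLib

/-!
# Ring 2 — hypotheses layer, descent axis: THE STABILISER OF THE ALGEBRAIC CLASSES ON THE POWERS OF AN ABELIAN VARIETY
# ACTS ON `H•(A(ℂ); ℂ) = ⋀•H¹` THROUGH `H¹` AND MULTIPLICATIVELY (van Geemen 6.5 for `G¹_alg(A) ⊇ G¹_mot(A) ⊇ G¹_AH(A) ⊇ Hg(A)`, part II)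

HONEST FRAMING (page 1, verbatim the cell's standing line): **research route conditional on HC_CM; not a
corollary; Q11.4-sentence-2 already refuted in dim ≥ 3.** Nothing in this file proves a case of the Hodge conjecture;
nothing discharges the binder of record b06 `Ring2.Hypotheses.AbsoluteHodgeImpliesAlgebraicAV` («absolute Hodge classes
on complex abelian varieties are algebraic», `Ring2HypothesesDescent.lean` :73; OPEN); the binder table's numbers do not
move. `HC_CM` (`Theses.RankFourFaces.CMAbelianHodge`), `HC_AV` and row b06 do not occur in this file. Hodge ladder STAGE 3,
`BINDER-OWNERS.md` row **b06**, seat `ring2-b06` (gen 84). Part II of the Künneth-family-level dictionary begun in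
`Ring2HypothesesDescentAbsoluteExteriorPullbacks` (same gen; see its module docstring for THE POINT): for a complex abelian variety
`A` and a Künneth family `G` on the powers `A^{×(a+1)}` FIXING EVERY ALGEBRAIC CLASS of every power (typer 2's system
`algebraicPowClasses A.X`; `G₀ = g ∈ G¹_alg(A)(ℂ) = algebraicStabilizer A.X`), the first member `g` acts on
`Hᵏ(A(ℂ); ℂ) = ⋀ᵏH¹` through `⋀ᵏ` of `g₁` and multiplicatively — van Geemen, LNM 1594, 6.5 «Since `G` acts on `V_ℚ` it also acts on
`∧ᵏV_ℚ = Hᵏ(X, ℚ)`», there for the Hodge group, here for the LARGEST group of the cell's Tannaka-free dictionary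
`G¹_alg ≥ G¹_mot ≥ G¹_AH ≥ Hg`. The proofs are those of the Literature file `HodgeTheory/HodgeGroupExteriorAction` VERBATIM with the
hypothesis `hfix` moved from the Hodge system to the algebraic system (each adapted declaration says so) — the one input being
that the graphs of the homomorphisms `p·pr₁ + pr₂ : A × A → A` give ALGEBRAIC transposed graph-type classes
(`Ring2HypothesesDescentAbsoluteExteriorGraphClasses`, `C(A)`), so that `G₁` commutes with `(p·pr₁ + pr₂)^*` (part I, `apply_map`).

* §E2 `map_fpX_one` (`(p·pr₁ + pr₂)^* = p·pr₁^* + pr₂^*` on `H¹`), the diagonal and the one-`pr₁`-factor monomials (the typed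
  `map_cross` at the first power is the Milne-1999 lane's `Milne1999.kunneth_cross_one`, reused), the averaging
  operator `𝒞 = Σ_p w_p (p·pr₁ + pr₂)^*` with Lagrange weights (`avg_cupPowOne`: `𝒞(∪vᵢ) = Σᵢ Mᵢ(v)`; `diag_avg`: `Δ^* ∘ 𝒞 = (k+1)·id`),
  **`apply_cupPowOne`** (`g_k(v₁ ∪ ⋯ ∪ v_k) = g₁v₁ ∪ ⋯ ∪ g₁v_k`), `apply_one`, **`map_cupProduct`** (`g(x ∪ y) = g x ∪ g y`).
  The group-level statements (for `algebraicStabilizer`, `G¹_AH`, `G¹_mot`, and the determination by `H¹`) are in the companion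
  `Ring2HypothesesDescentAbsoluteExteriorGroups` (same gen).

HONEST COLUMN. Nothing is discharged; «10 · 0» unchanged; no hypothesis of the cell occurs; no definition (the averaging operator,
written `𝒞` above, is an inline sum over ANY morphisms `f_p` with `f_p^* = p·pr₁^* + pr₂^*` on `H¹`; the monomials are inline
`cupPowOne`s of an updated family), no named fact, no sorry; FACT-FREE. NOT obtained: the same for a general smooth projective `X`
(needs `C(X)`); anything deciding the row.

PRESEARCH: as in part I — [corpus: paper:doi-10-1007-978-3-540-49046-3-5 (van Geemen LNM 1594) 6.4–6.7; book:deligne1982-hodge-cycles-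
motives-shimura-varieties p0043 (I §3)]; hybrid / vsearch / galaxy as recorded there; certification by assembly, no novelty claimed.
References (bib keys): vanGeemen1994HodgeAV (6.4–6.7), LangeBirkenhake1992 (§1.1 p. 19, Lemma 1.1.17, Exercise 1.1.6 (7)),
Deligne1982HodgeCycles (I §3), Andre1996Motifs (§4.6 (ii)), HatcherAT2002 (§3.2 Prop. 3.10, Thm. 3.11), Kleiman1968AlgebraicCycles (§2 App. 2A).
-/

noncomputable section

-- every declaration of this problem lives in `Summit.HodgeConjecture.HodgeConjecture.…` (summit = sub-problem)
set_option linter.dupNamespace false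

namespace Summit.HodgeConjecture.HodgeConjecture.Ring2.Hypotheses

open CategoryTheory AlgebraicGeometry MonoidalCategory CartesianMonoidalCategory
open Literature.AlgebraicGeometry Literature.AlgebraicGeometry.Motives
open Literature.AlgebraicGeometry.HodgeTheory
open Literature.AlgebraicTopology.SingularHomology

namespace AlgebraicStabilizerExterior

/-! ## §E2 The action on `Hᵏ(A(ℂ); ℂ) = ⋀ᵏH¹` through `H¹` -/

section Abelian

variable (A : AbelianVariety ℂ)
  {g : ∀ k : ℕ, complexBetti A.X k ≃ₗ[ℂ] complexBetti A.X k}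
  {G : ∀ a k : ℕ, complexBetti (cartesianPow A.X (a + 1)) k ≃ₗ[ℂ] complexBetti (cartesianPow A.X (a + 1)) k}
  {G1 : ∀ k : ℕ, complexBetti (A.X ⊗ A.X) k ≃ₗ[ℂ] complexBetti (A.X ⊗ A.X) k}

/-- `f_p^* x = p·pr₁^* x + pr₂^* x` on `H¹(A(ℂ); ℂ)` for the homomorphism `f_p = p·pr₁ + pr₂ : A × A → A`
(additivity of `f ↦ f^*` on `H¹`, the tree's `complexBetti_map_add_one`).
-- adapted from Literature/AlgebraicGeometry/HodgeTheory/HodgeGroupExteriorAction.lean (`HodgeGroupExterior.map_fpX_one`)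
[cite: LangeBirkenhake1992, §1.1 (p. 19)] -/
theorem map_fpX_one (p : ℕ) (x : complexBetti A.X 1) :
    complexBetti.map (p • AbelianVariety.fst A A + AbelianVariety.snd A A).hom.hom.hom 1 x =
      (p : ℂ) • complexBetti.map (fst A.X A.X) 1 x + complexBetti.map (snd A.X A.X) 1 x := by
  rw [complexBetti_map_add_one, complexBetti_map_nsmul_one]
  change ((p • complexBetti.map (AbelianVariety.fst A A).hom.hom.hom 1 +
    complexBetti.map (AbelianVariety.snd A A).hom.hom.hom 1).hom) x = _
  rw [ModuleCat.hom_add, ModuleCat.hom_nsmul, LinearMap.add_apply, LinearMap.smul_apply,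
    Nat.cast_smul_eq_nsmul]
  rfl

/-- `Δ^* pr₁^* = id` for the diagonal `Δ = (𝟙, 𝟙) : A → A × A`.
-- adapted from Literature/AlgebraicGeometry/HodgeTheory/HodgeGroupExteriorAction.lean (`HodgeGroupExterior.diag_map_fst`)
[folklore] -/
theorem diag_map_fst (k : ℕ) (x : complexBetti A.X k) :
    complexBetti.map (CartesianMonoidalCategory.lift (𝟙 A.X) (𝟙 A.X)) k (complexBetti.map (fst A.X A.X) k x) = x := by
  rw [← ModuleCat.comp_apply, ← complexBetti.map_comp, CartesianMonoidalCategory.lift_fst,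
    complexBetti.map_id, ModuleCat.id_apply]

/-- `Δ^* pr₂^* = id`.
-- adapted from Literature/AlgebraicGeometry/HodgeTheory/HodgeGroupExteriorAction.lean (`HodgeGroupExterior.diag_map_snd`)
[folklore] -/
theorem diag_map_snd (k : ℕ) (x : complexBetti A.X k) :
    complexBetti.map (CartesianMonoidalCategory.lift (𝟙 A.X) (𝟙 A.X)) k (complexBetti.map (snd A.X A.X) k x) = x := by
  rw [← ModuleCat.comp_apply, ← complexBetti.map_comp, CartesianMonoidalCategory.lift_snd,
    complexBetti.map_id, ModuleCat.id_apply]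

/-- `Δ^* M_i(v) = v₀ ∪ ⋯ ∪ v_k` for the one-`pr₁`-factor monomial `M_i(v) = pr₂^*v₀ ∪ ⋯ ∪ pr₁^*v_i ∪ ⋯ ∪ pr₂^*v_k`.
-- adapted from Literature/AlgebraicGeometry/HodgeTheory/HodgeGroupExteriorAction.lean (`HodgeGroupExterior.diag_map_M1`)
[folklore] -/
theorem diag_map_M1 (k : ℕ) (v : Fin k → complexBetti A.X 1) (i : Fin k) :
    complexBetti.map (CartesianMonoidalCategory.lift (𝟙 A.X) (𝟙 A.X)) k
        (cupPowOne ℂ (ComplexPoints (A.X ⊗ A.X)) k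
          (Function.update (fun j ↦ complexBetti.map (snd A.X A.X) 1 (v j)) i (complexBetti.map (fst A.X A.X) 1 (v i)))) =
      cupPowOne ℂ (ComplexPoints A.X) k v := by
  classical
  rw [complexBetti_map_cupPowOne]
  congr 1
  funext j
  by_cases hj : j = i
  · subst hj
    rw [Function.update_self, diag_map_fst]
  · rw [Function.update_of_ne hj, diag_map_snd]

/-- `M_i(v) = (-1)^i · pr₁^* v_i ∪ pr₂^*(∪_{j ≠ i} v_j)`.
-- adapted from Literature/AlgebraicGeometry/HodgeTheory/HodgeGroupExteriorAction.lean (`HodgeGroupExterior.M1_eq`)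
[folklore] -/
theorem M1_eq (k : ℕ) (v : Fin (k + 1) → complexBetti A.X 1) (i : Fin (k + 1)) :
    cupPowOne ℂ (ComplexPoints (A.X ⊗ A.X)) (k + 1)
        (Function.update (fun j ↦ complexBetti.map (snd A.X A.X) 1 (v j)) i (complexBetti.map (fst A.X A.X) 1 (v i))) =
      ((-1 : ℂ) ^ (i : ℕ)) •
      cupProduct (Nat.add_comm 1 k) (complexBetti.map (fst A.X A.X) 1 (v i))
        (complexBetti.map (snd A.X A.X) k (cupPowOne ℂ (ComplexPoints A.X) k (v ∘ i.succAbove))) := by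
  classical
  rw [HodgeGroupExterior.cupPowOne_eq_sign_smul_cons k _ i]
  congr 1
  rw [← cupProduct_cupPowOne, Function.update_self, complexBetti_map_cupPowOne]
  congr 2
  funext j
  simp only [Function.comp_apply]
  rw [Function.update_of_ne (Fin.succAbove_ne i j)]

variable {A}

/-- `G₁` commutes with `f^*` for every `f : A × A → A` (typed copy of `apply_map`, `a = 1`).
-- adapted from Literature/AlgebraicGeometry/HodgeTheory/HodgeGroupExteriorAction.lean (`HodgeGroupExterior.kunneth_one_apply_map`)
[folklore] -/
theorem one_apply_map (hG : IsKunnethFamily A.X G) (h0 : G 0 = g) (h1 : G 1 = G1)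
    (hfix : ∀ (a p : ℕ), ∀ x ∈ algebraicPowClasses A.X a p, G a (2 * p) x = x)
    (f : A.X ⊗ A.X ⟶ A.X) (k : ℕ) (y : complexBetti A.X k) :
    G1 k (complexBetti.map f k y) = complexBetti.map f k (g k y) := by
  have := apply_map hG h0 hfix 1 f k y
  rw [h1] at this
  exact this

/-- The induction step on the `G`-side: `G₁ M_i(v) = M_i(g ∘ v)`, granted the claim in degree `k`.
-- adapted from Literature/AlgebraicGeometry/HodgeTheory/HodgeGroupExteriorAction.lean (`HodgeGroupExterior.kunneth_M1`)
[folklore] -/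
theorem kunneth_M1 (hG : IsKunnethFamily A.X G) (h0 : G 0 = g) (h1 : G 1 = G1) (k : ℕ)
    (ih : ∀ u : Fin k → complexBetti A.X 1,
      g k (cupPowOne ℂ (ComplexPoints A.X) k u) = cupPowOne ℂ (ComplexPoints A.X) k (fun j ↦ g 1 (u j)))
    (v : Fin (k + 1) → complexBetti A.X 1) (i : Fin (k + 1)) :
    G1 (k + 1) (cupPowOne ℂ (ComplexPoints (A.X ⊗ A.X)) (k + 1)
        (Function.update (fun j ↦ complexBetti.map (snd A.X A.X) 1 (v j)) i (complexBetti.map (fst A.X A.X) 1 (v i)))) =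
      cupPowOne ℂ (ComplexPoints (A.X ⊗ A.X)) (k + 1)
        (Function.update (fun j ↦ complexBetti.map (snd A.X A.X) 1 (g 1 (v j))) i
          (complexBetti.map (fst A.X A.X) 1 (g 1 (v i)))) := by
  rw [M1_eq, M1_eq A k (fun j ↦ g 1 (v j)) i, map_smul, Milne1999.kunneth_cross_one hG h0 h1, ih]
  rfl

/-- `𝒞 (v₀ ∪ ⋯ ∪ v_k) = Σ_i M_i(v)` for the averaging operator `𝒞 = Σ_p w_p f_p^*` with Lagrange weights
`Σ_p w_p pʳ = [r = 1]` (`r ≤ k + 1`), for any morphisms `f_p : A × A → A` with `f_p^* = p·pr₁^* + pr₂^*` on `H¹`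
(the homomorphisms `p·pr₁ + pr₂`, `map_fpX_one`).
-- adapted from Literature/AlgebraicGeometry/HodgeTheory/HodgeGroupExteriorAction.lean (`HodgeGroupExterior.avgOp_cupPowOne`,
-- the averaging operator written inline)
[cite: LangeBirkenhake1992, §1.1 (p. 19)] -/
theorem avg_cupPowOne (fp : ℕ → (A.X ⊗ A.X ⟶ A.X))
    (hfp : ∀ (p : ℕ) (x : complexBetti A.X 1), complexBetti.map (fp p) 1 x =
      (p : ℂ) • complexBetti.map (fst A.X A.X) 1 x + complexBetti.map (snd A.X A.X) 1 x)
    {k : ℕ} {w : Fin (k + 2) → ℂ}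
    (hw : ∀ r : ℕ, r ≤ k + 1 → ∑ p : Fin (k + 2), w p * ((p : ℕ) : ℂ) ^ r = if r = 1 then 1 else 0)
    (v : Fin (k + 1) → complexBetti A.X 1) :
    ∑ p : Fin (k + 2), w p • complexBetti.map (fp p) (k + 1) (cupPowOne ℂ (ComplexPoints A.X) (k + 1) v) =
      ∑ i, cupPowOne ℂ (ComplexPoints (A.X ⊗ A.X)) (k + 1)
        (Function.update (fun j ↦ complexBetti.map (snd A.X A.X) 1 (v j)) i (complexBetti.map (fst A.X A.X) 1 (v i))) := by
  classical
  have hexp : ∀ p : Fin (k + 2), complexBetti.map (fp p) (k + 1) (cupPowOne ℂ (ComplexPoints A.X) (k + 1) v) =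
      ∑ S : Finset (Fin (k + 1)), (((p : ℕ) : ℂ) ^ S.card) • cupPowOne ℂ (ComplexPoints (A.X ⊗ A.X)) (k + 1)
        (S.piecewise (fun j ↦ complexBetti.map (fst A.X A.X) 1 (v j))
          (fun j ↦ complexBetti.map (snd A.X A.X) 1 (v j))) := by
    intro p
    rw [complexBetti_map_cupPowOne]
    simp_rw [hfp]
    exact HodgeGroupExterior.cupPowOne_smul_add (k + 1) _ _ _
  simp_rw [hexp, Finset.smul_sum, smul_smul]
  rw [Finset.sum_comm]
  simp_rw [← Finset.sum_smul]
  -- the weights kill every `S` with `|S| ≠ 1`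
  have hwS : ∀ S : Finset (Fin (k + 1)), ∑ p : Fin (k + 2), w p * ((p : ℕ) : ℂ) ^ S.card =
      if S.card = 1 then 1 else 0 := by
    intro S
    have hS : S.card ≤ k + 1 := by
      have := S.card_le_univ; simp only [Fintype.card_fin] at this; omega
    exact hw S.card hS
  simp_rw [hwS, ite_smul, one_smul, zero_smul]
  rw [Finset.sum_ite, Finset.sum_const_zero, add_zero]
  -- the singletons
  have hfilter : (Finset.univ.filter fun S : Finset (Fin (k + 1)) ↦ S.card = 1) =
      (Finset.univ : Finset (Fin (k + 1))).powersetCard 1 := by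
    rw [Finset.powersetCard_eq_filter, Finset.powerset_univ]
  rw [hfilter, Finset.powersetCard_one, Finset.sum_map]
  refine Finset.sum_congr rfl fun i _ ↦ ?_
  change cupPowOne ℂ _ (k + 1) (({i} : Finset (Fin (k + 1))).piecewise _ _) = _
  congr 1
  funext j
  by_cases hj : j = i
  · subst hj; simp
  · simp [hj]

/-- `Δ^* ∘ 𝒞 = (k + 1) · id` on `H^{k+1}(A(ℂ); ℂ)` (checked on the spanning monomials `v₀ ∪ ⋯ ∪ v_k`), for the averaging
operator `𝒞 = Σ_p w_p f_p^*` of any morphisms `f_p` with `f_p^* = p·pr₁^* + pr₂^*` on `H¹`.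
-- adapted from Literature/AlgebraicGeometry/HodgeTheory/HodgeGroupExteriorAction.lean (`HodgeGroupExterior.diag_avgOp`,
-- the averaging operator written inline)
[cite: LangeBirkenhake1992, Lemma 1.1.17] -/
theorem diag_avg (fp : ℕ → (A.X ⊗ A.X ⟶ A.X))
    (hfp : ∀ (p : ℕ) (x : complexBetti A.X 1), complexBetti.map (fp p) 1 x =
      (p : ℂ) • complexBetti.map (fst A.X A.X) 1 x + complexBetti.map (snd A.X A.X) 1 x)
    {k : ℕ} {w : Fin (k + 2) → ℂ}
    (hw : ∀ r : ℕ, r ≤ k + 1 → ∑ p : Fin (k + 2), w p * ((p : ℕ) : ℂ) ^ r = if r = 1 then 1 else 0)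
    (y : complexBetti A.X (k + 1)) :
    complexBetti.map (CartesianMonoidalCategory.lift (𝟙 A.X) (𝟙 A.X)) (k + 1)
        (∑ p : Fin (k + 2), w p • complexBetti.map (fp p) (k + 1) y) = ((k + 1 : ℕ) : ℂ) • y := by
  have hspan := (abelianVarietyCohomologyExteriorH1_holds.hasExteriorCohomologyH1 A).span_range_cupPowOne (k + 1)
  -- the averaging operator as a linear map
  let C : complexBetti A.X (k + 1) →ₗ[ℂ] complexBetti (A.X ⊗ A.X) (k + 1) :=
    ∑ p : Fin (k + 2), w p • (complexBetti.map (fp p) (k + 1)).hom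
  have hCapply : ∀ z : complexBetti A.X (k + 1), C z = ∑ p : Fin (k + 2), w p • complexBetti.map (fp p) (k + 1) z := by
    intro z
    simp only [C, LinearMap.coe_sum, Finset.sum_apply, LinearMap.smul_apply]
  have key : (complexBetti.map (CartesianMonoidalCategory.lift (𝟙 A.X) (𝟙 A.X)) (k + 1)).hom ∘ₗ C =
      ((k + 1 : ℕ) : ℂ) • LinearMap.id := by
    refine LinearMap.ext_on_range hspan fun v ↦ ?_
    rw [LinearMap.comp_apply, LinearMap.smul_apply, LinearMap.id_apply, hCapply]
    change complexBetti.map (CartesianMonoidalCategory.lift (𝟙 A.X) (𝟙 A.X)) (k + 1)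
      (∑ p : Fin (k + 2), w p • complexBetti.map (fp p) (k + 1) (cupPowOne ℂ (ComplexPoints A.X) (k + 1) v)) = _
    rw [avg_cupPowOne fp hfp hw, map_sum]
    simp_rw [diag_map_M1]
    rw [Finset.sum_const, Finset.card_univ, Fintype.card_fin, ← Nat.cast_smul_eq_nsmul ℂ]
  have := LinearMap.congr_fun key y
  rw [LinearMap.comp_apply, hCapply] at this
  simpa using this

/-- **van Geemen 6.5 for a Künneth family fixing the ALGEBRAIC classes on the powers of `A`**: `g = G₀` satisfies
`g_k(v₁ ∪ ⋯ ∪ v_k) = g₁v₁ ∪ ⋯ ∪ g₁v_k` for all `k` and `vᵢ ∈ H¹(A(ℂ); ℂ)` — induction on `k` with the averaging operator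
`𝒞 = Σ_p w_p (p·pr₁ + pr₂)^*` (which commutes with `G`, `apply_map`: the graphs of the homomorphisms `p·pr₁ + pr₂` give
ALGEBRAIC transposed graph-type classes), `𝒞(∪vᵢ) = Σᵢ Mᵢ(v)` and `Δ^* ∘ 𝒞 = (k+1)·id`; the Lagrange weights are
ring2-ab-andre-2's `exists_vandermonde_solution`.
-- adapted from Literature/AlgebraicGeometry/HodgeTheory/HodgeGroupExteriorAction.lean (`HodgeGroupExterior.kunneth_cupPowOne`,
-- hypothesis `hfix` moved from the Hodge system to the algebraic system)
[cite: vanGeemen1994HodgeAV, 6.4–6.5] [cite: LangeBirkenhake1992, §1.1 (p. 19) and Lemma 1.1.17] [cite: Andre1996Motifs, §4.6 (ii) (p. 24)] -/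
theorem apply_cupPowOne (hG : IsKunnethFamily A.X G) (h0 : G 0 = g) (h1 : G 1 = G1)
    (hfix : ∀ (a p : ℕ), ∀ x ∈ algebraicPowClasses A.X a p, G a (2 * p) x = x) :
    ∀ (k : ℕ) (v : Fin k → complexBetti A.X 1),
      g k (cupPowOne ℂ (ComplexPoints A.X) k v) = cupPowOne ℂ (ComplexPoints A.X) k (fun j ↦ g 1 (v j)) := by
  -- the homomorphisms `f_p = p·pr₁ + pr₂ : A × A → A` as morphisms of `ℂ`-schemes, `f_p^* = p·pr₁^* + pr₂^*` on `H¹`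
  let fp : ℕ → (A.X ⊗ A.X ⟶ A.X) := fun p ↦ (p • AbelianVariety.fst A A + AbelianVariety.snd A A).hom.hom.hom
  have hfp : ∀ (p : ℕ) (x : complexBetti A.X 1), complexBetti.map (fp p) 1 x =
      (p : ℂ) • complexBetti.map (fst A.X A.X) 1 x + complexBetti.map (snd A.X A.X) 1 x := fun p x ↦ map_fpX_one A p x
  intro k
  induction k with
  | zero =>
    intro v
    rw [cupPowOne_zero, cupPowOne_zero]
    have := hfix 0 0 _ (one_mem_algebraicPowClasses_zero A.X)
    rw [h0] at this
    exact this
  | succ k ih =>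
    intro v
    obtain ⟨w, hw⟩ := Ring2.AbelianAll.exists_vandermonde_solution (k + 1) 1
    -- `𝒞 (g y) = G₁ (𝒞 y) = G₁ (Σ M_i v) = Σ M_i (g ∘ v) = 𝒞 (∪ g v_j)`
    have hC : ∑ p : Fin (k + 2), w p • complexBetti.map (fp p) (k + 1) (g (k + 1) (cupPowOne ℂ (ComplexPoints A.X) (k + 1) v)) =
        ∑ p : Fin (k + 2), w p • complexBetti.map (fp p) (k + 1)
          (cupPowOne ℂ (ComplexPoints A.X) (k + 1) (fun j ↦ g 1 (v j))) := by
      have step : (∑ p : Fin (k + 2), w p • complexBetti.map (fp p) (k + 1)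
          (g (k + 1) (cupPowOne ℂ (ComplexPoints A.X) (k + 1) v))) =
          G1 (k + 1) (∑ p : Fin (k + 2), w p • complexBetti.map (fp p) (k + 1) (cupPowOne ℂ (ComplexPoints A.X) (k + 1) v)) := by
        rw [map_sum]
        refine Finset.sum_congr rfl fun p _ ↦ ?_
        rw [map_smul, one_apply_map hG h0 h1 hfix (fp p) (k + 1)]
      rw [step, avg_cupPowOne fp hfp hw, avg_cupPowOne fp hfp hw, map_sum]
      exact Finset.sum_congr rfl fun i _ ↦ kunneth_M1 hG h0 h1 k ih v i
    have h2 := congrArg (complexBetti.map (CartesianMonoidalCategory.lift (𝟙 A.X) (𝟙 A.X)) (k + 1)) hC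
    rw [diag_avg fp hfp hw, diag_avg fp hfp hw] at h2
    exact smul_right_injective _ (Nat.cast_ne_zero.2 (Nat.succ_ne_zero k)) h2

/-- `g₀ 1 = 1` on `H⁰(A(ℂ); ℂ)` (`1` is algebraic). [folklore] -/
theorem apply_one (h0 : G 0 = g) (hfix : ∀ (a p : ℕ), ∀ x ∈ algebraicPowClasses A.X a p, G a (2 * p) x = x) :
    g 0 (singularCohomology.one ℂ (ComplexPoints A.X)) = singularCohomology.one ℂ (ComplexPoints A.X) := by
  have := hfix 0 0 _ (one_mem_algebraicPowClasses_zero A.X)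
  rw [h0] at this
  exact this

/-- Multiplicativity with a degree-one factor: `g (w ∪ z) = g w ∪ g z`, `w ∈ H¹` (checked on monomials `z`).
-- adapted from Literature/AlgebraicGeometry/HodgeTheory/HodgeGroupExteriorAction.lean (`HodgeGroupExterior.kunneth_cupProduct_one`)
[folklore] -/
theorem map_cupProduct_one (hG : IsKunnethFamily A.X G) (h0 : G 0 = g) (h1 : G 1 = G1)
    (hfix : ∀ (a p : ℕ), ∀ x ∈ algebraicPowClasses A.X a p, G a (2 * p) x = x)
    {k' k : ℕ} (h : 1 + k' = k) (w : complexBetti A.X 1) (z : complexBetti A.X k') :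
    g k (cupProduct h w z) = cupProduct h (g 1 w) (g k' z) := by
  obtain rfl : k = k' + 1 := by omega
  have hspan := (abelianVarietyCohomologyExteriorH1_holds.hasExteriorCohomologyH1 A).span_range_cupPowOne k'
  have key : (g (k' + 1) : complexBetti A.X (k' + 1) →ₗ[ℂ] complexBetti A.X (k' + 1)) ∘ₗ cupProduct h w =
      cupProduct h (g 1 w) ∘ₗ (g k' : complexBetti A.X k' →ₗ[ℂ] complexBetti A.X k') := by
    refine LinearMap.ext_on_range hspan fun u ↦ ?_
    simp only [LinearMap.coe_comp, LinearEquiv.coe_coe, Function.comp_apply]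
    rw [apply_cupPowOne hG h0 h1 hfix k' u, cupProduct_cupPowOne, cupProduct_cupPowOne,
      apply_cupPowOne hG h0 h1 hfix (k' + 1)]
    congr 1
    funext j
    refine Fin.cases ?_ (fun j' ↦ ?_) j
    · simp
    · simp
  exact LinearMap.congr_fun key z

/-- **Multiplicativity**: a Künneth family fixing the algebraic classes on the powers of `A` has `g = G₀` with
`g (x ∪ y) = g x ∪ g y` on `H•(A(ℂ); ℂ) = ⋀•H¹` (induction on the degree of `x` through the spanning monomials).
-- adapted from Literature/AlgebraicGeometry/HodgeTheory/HodgeGroupExteriorAction.lean (`HodgeGroupExterior.kunneth_cupProduct`,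
-- hypothesis `hfix` moved from the Hodge system to the algebraic system)
[cite: vanGeemen1994HodgeAV, 6.5] [cite: LangeBirkenhake1992, Lemma 1.1.17 and Exercise 1.1.6 (7)] -/
theorem map_cupProduct (hG : IsKunnethFamily A.X G) (h0 : G 0 = g) (h1 : G 1 = G1)
    (hfix : ∀ (a p : ℕ), ∀ x ∈ algebraicPowClasses A.X a p, G a (2 * p) x = x) :
    ∀ (i j k : ℕ) (h : i + j = k) (x : complexBetti A.X i) (y : complexBetti A.X j),
      g k (cupProduct h x y) = cupProduct h (g i x) (g j y) := by
  intro i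
  induction i with
  | zero =>
    intro j k h x y
    obtain rfl : k = j := by omega
    have hspan := (abelianVarietyCohomologyExteriorH1_holds.hasExteriorCohomologyH1 A).span_range_cupPowOne 0
    have hx : x ∈ Submodule.span ℂ (Set.range (cupPowOne ℂ (ComplexPoints A.X) 0)) := by
      rw [hspan]; exact Submodule.mem_top
    have hrange : Set.range (cupPowOne ℂ (ComplexPoints A.X) 0) = {singularCohomology.one ℂ (ComplexPoints A.X)} := by
      ext c
      simp only [Set.mem_range, cupPowOne_zero, Set.mem_singleton_iff]
      exact ⟨fun ⟨_, hc⟩ ↦ hc.symm, fun hc ↦ ⟨fun i ↦ i.elim0, hc.symm⟩⟩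
    rw [hrange, Submodule.mem_span_singleton] at hx
    obtain ⟨c, rfl⟩ := hx
    have hone : ∀ z : complexBetti A.X k, cupProduct h (singularCohomology.one ℂ (ComplexPoints A.X)) z = z :=
      fun z ↦ one_cupProduct z
    rw [LinearMap.map_smul₂, map_smul (g k), map_smul (g 0), apply_one h0 hfix, LinearMap.map_smul₂, hone, hone]
  | succ i ih =>
    intro j k h x y
    have hspan := (abelianVarietyCohomologyExteriorH1_holds.hasExteriorCohomologyH1 A).span_range_cupPowOne (i + 1)
    have key : (g k : complexBetti A.X k →ₗ[ℂ] complexBetti A.X k) ∘ₗ (cupProduct h).flip y =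
        (cupProduct h).flip (g j y) ∘ₗ (g (i + 1) : complexBetti A.X (i + 1) →ₗ[ℂ] complexBetti A.X (i + 1)) := by
      refine LinearMap.ext_on_range hspan fun u ↦ ?_
      simp only [LinearMap.coe_comp, LinearEquiv.coe_coe, Function.comp_apply, LinearMap.flip_apply]
      rw [cupPowOne_succ, cupProduct_assoc (Nat.add_comm 1 i) rfl h (by omega),
        map_cupProduct_one hG h0 h1 hfix (by omega), ih j (i + j) rfl,
        ← cupProduct_assoc (Nat.add_comm 1 i) rfl h (by omega),
        ← map_cupProduct_one hG h0 h1 hfix (Nat.add_comm 1 i)]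
    have := LinearMap.congr_fun key x
    simpa using this

end Abelian

end AlgebraicStabilizerExterior

end Summit.HodgeConjecture.HodgeConjecture.Ring2.Hypotheses

end
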